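import Literature.IUT.HodgeTheaters.Cor53iArithUnitsEndOfCor411
import Literature.IUT.HodgeTheaters.Cor53iBRatioOfUnitsTransport
import Literature.IUT.HodgeTheaters.Cor53iLiftsAllAtArithmeticGlobalModel
import HarnessLib

/-!
# [IUTchI] Cor 5.3 (i) at the GENUINE `ℱ^⊛(†𝒟^⊚)`: the Ex 5.1 (v) binder `hB` (𝔹-RATIO) DISCHARGED — `hker⊛` and the
# injectivity of `Aut(ℱ^⊛) → Aut(†𝒟^⊛)` UNCONDITIONAL; Cor 5.3 (i) as printed modulo the lift `hlift⊛` alone (Neukirch–Uchida)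

S. Mochizuki, *Inter-universal Teichmüller theory I*, kurims manuscript (May 2020), §5 Cor 5.3 (i) p. 144 l. 2–11, proof l. 24–33
(«follows immediately from the category-theoreticity of the "isomorphism `𝕄^⊛(†𝒟^⊚) ⥲ †𝕄^⊛`" of Example 5.1, (v)»); Ex 5.1 (v)
pp. 127–129 («from the elementary observation that … `ℚ_{>0} ∩ Ẑ^× = {1}`») ([IUTchI] Cor 5.3 (i) p.144; Ex 5.1 (v) p.128)
[claim: Mochizuki2012, status: disputed] (D-0012 claim key; this file PROVES statements about the cell's typed carriers; nothing of the
series is asserted; no side taken on [IUTchIII] Cor. 3.12).  [FrdI]: S. Mochizuki, *The geometry of Frobenioids I*, Kyushu J. Math.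
**62** (2008), Cor 4.10 p. 90, Cor 4.11 pp. 91–92, Thm 5.2 (ii) p. 101, Ex 6.3 p. 113 [cite: MochizukiFrdI2008, Thm. 5.2 (ii) p.101].

PROOF-ONLY KNIT (cell abc-iut, seat abc-iut-L5-t11 gen 17, row K2-c «COR53I-BRATIO» of GAP D-G-L5t11g16-2, abc-iut-L5-lead gen 10
POST-ROUND ROWS 13:40:42Z; 0 def / 0 instance / 0 notation / no Prop fact; ONE-LINERS).  STATE OF RECORD before this file: ★
`Cor53iArithHratOfMonoidRigidity` closes `hker⊛ := RigidOverBase (arith F).modelBase` from the single displayed binder `hB` = 𝔹-RATIO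
(FACT-SHAPE ≙ F-2577): «every self-equivalence `Ψ` of `ℱ^⊛(†𝒟^⊚)` over the identity of `†𝒟^⊛` preserves through some base
identification the rational function `u_f/u_g` of every pair of parallel linear arrows».  The BRATIO split:
(a) «C411-UNITS@ARITH» (this seat, ★ `Cor53iModelRatioTransport` + ★ `Cor53iArithUnitsEndOfCor411`): `Ψ` moves the rational
    functions through ONE natural automorphism `ᾱ` of `𝔹 = (A ↦ (F̄^{H_A})^×)`, `Div`-compatible through monoid automorphisms of
    `Φ^⊛(A)`, with the (hratio) clause holding WITH `ᾱ` INSERTED ([FrdI] Cor 4.10 + Thm 5.2 (ii), hypothesis-free);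
(b) «BRIGID-KUMMER» (abc-iut-L5-t16, ★ `GaloisEquivariantUnitsEndomorphismRigidity` / ★ `UnitsFunctorAutRigidity` / ★
    `GlobalFrobenioidsArithBNatEndRigidity`): such an `ᾱ` is the IDENTITY (Kummer theory + finiteness of the class group — print's
    «`ℚ_{>0} ∩ Ẑ^× = {1}`»; classical, OURS);
(pre-knit) abc-iut-L5-t16's ★ `Cor53iBRatioOfUnitsTransport`: (a)-shape `hA` ⇒ `hB` ⇒ `hker⊛` ⇒ Cor 5.3 (i) modulo `hlift⊛`.
THIS FILE plugs (a) into the pre-knit: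
* **`Cor53.arith_ratioRigid`** — `hB` (𝔹-RATIO) at `ℱ^⊛(†𝒟^⊚)` is a THEOREM (no hypothesis);
* **`Cor53.arith_rigidOverBase`** — `hker⊛ = RigidOverBase (arith F).modelBase` UNCONDITIONAL: every self-equivalence of
  `ℱ^⊛(†𝒟^⊚)` over the identity of `†𝒟^⊛` is isomorphic to the identity;
* **`Cor53.arith_descend_injective`** — the natural map `Aut(ℱ^⊛(†𝒟^⊚)) → Aut(†𝒟^⊛)` (§0 `CatIsomorphism.descend`) is INJECTIVE,
  UNCONDITIONALLY (the injectivity half of Cor 5.3 (i) at the genuine carrier);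
* `Cor53.arith_descendBijective_of_lifts (hlift)` / **`Cor53.arith_descendBijective_of_neukirchUchida (hNU)`** — Cor 5.3 (i) AS
  PRINTED («bijective») at `ℱ^⊛(†𝒟^⊚)` modulo the SURJECTIVITY input alone: `hlift⊛` displayed, resp. discharged by abc-iut-w4-d109's
  ★ `liftsAll_modelBase_arith_of_neukirchUchida` modulo the named FACT `NeukirchUchida F` ([NSW] (12.2.1), BY NAME).
CENSUS of the `⊛`-slot of IUTchI:Cor5.3(i) after this file: injectivity — LAW ∅ · FACT ∅ · GAP ∅ (PROVED); bijectivity — FACT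
{`NeukirchUchida`} only.  HONEST TAGS: this is OUR kernel bookkeeping about OUR typed carrier `ℱ^⊛(†𝒟^⊚)` = the [FrdI] Ex 6.3 /
Thm 5.2 model over `ℬ(G_F)⁰` (scope notes of ★ `GlobalFrobenioidsArithmeticModel` apply: `π₁(†𝒟^⊛)` IS `G_{F_mod}`, non-stack-theoretic
divisors); the `⊚`-twin `hB⊚` is NOT discharged here (its number-theoretic half along a general whiskering is not claimed, cf. ★
`Cor53iArithUnitsEndOfCor411` § 1⊚); nothing here asserts abc proved or refuted.
-/

noncomputable section

namespace Literature.IUT.HodgeTheaters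

open CategoryTheory Opposite Literature.AlgebraicGeometry.Frobenioids Literature.NumberTheory.GaloisRepresentations

namespace Cor53

variable (F : Type) [Field F] [NumberField F]

/-- **𝔹-RATIO (`hB`) at `ℱ^⊛(†𝒟^⊚)` is a THEOREM**: every self-equivalence `Ψ` of `ℱ^⊛(†𝒟^⊚)` over the identity of `†𝒟^⊛`
preserves, through ANY base identification `η` (there is exactly one, ★ `arith_overBase_iso_unique`), the rational function of every pair
of parallel linear arrows: `u_{Ψ f} · η_X^*(u_g) = u_{Ψ g} · η_X^*(u_f)` — the binder `hB` of ★ `Cor53.arith_rigidOverBase_of_ratioRigid`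
VERBATIM.  (a) this seat's ★ `arith_exists_unitsAut_of_overBase` ([FrdI] Cor 4.10 / Thm 5.2 (ii)) fed to abc-iut-L5-t16's pre-knit ★
`arith_ratioRigid_of_unitsTransport`, whose engine is (b) ★ `arith_B_unitsFamily_apply_eq_self_of_divB_compat` (classical rigidity).
([IUTchI] Cor 5.3 (i) p.144; Ex 5.1 (v) p.128) [cite: MochizukiFrdI2008, Thm. 5.2 (ii) p.101] [claim: Mochizuki2012, status: disputed] -/
theorem arith_ratioRigid :
    ∀ Ψ : (GlobalDivisorData.arith F).ModelGlobalFrobenioid ≌ (GlobalDivisorData.arith F).ModelGlobalFrobenioid,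
      Nonempty (Ψ.functor ⋙ (GlobalDivisorData.arith F).modelBase ≅ (GlobalDivisorData.arith F).modelBase) →
      ∃ η : Ψ.functor ⋙ (GlobalDivisorData.arith F).modelBase ≅ (GlobalDivisorData.arith F).modelBase,
        ∀ ⦃X Y : (GlobalDivisorData.arith F).ModelGlobalFrobenioid⦄ (f g : X ⟶ Y), ModelFrobenioid.degFr f = 1 →
          ModelFrobenioid.degFr g = 1 → ModelFrobenioid.baseMap f = ModelFrobenioid.baseMap g →
            ModelFrobenioid.unit (Ψ.functor.map f) *
                pull (GlobalDivisorData.arith F).B (A := X.base) (B := (Ψ.functor.obj X).base) (η.hom.app X)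
                  (ModelFrobenioid.unit g) =
              ModelFrobenioid.unit (Ψ.functor.map g) *
                pull (GlobalDivisorData.arith F).B (A := X.base) (B := (Ψ.functor.obj X).base) (η.hom.app X)
                  (ModelFrobenioid.unit f) :=
  arith_ratioRigid_of_unitsTransport F (fun Ψ η => arith_exists_unitsAut_of_overBase F Ψ η)

/-- **[IUTchI] Cor 5.3 (i), injectivity content at the GENUINE `ℱ^⊛(†𝒟^⊚)`, UNCONDITIONAL: `hker⊛ = RigidOverBase (arith F).modelBase`**
— every self-equivalence of `ℱ^⊛(†𝒟^⊚)` lying over the identity of `†𝒟^⊛ = ℬ(G_F)⁰` is isomorphic to the identity self-equivalence.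
The (k2) binder of abc-iut-L5-t4's ★ `Cor53TelescopeCensusKnit` at the `⊛`-carrier with NO hypothesis left: [FrdI] Cor 4.11 (iv)
(abc-iut-w4-d109) · Φ-RIGID-PRINC (abc-iut-L5-t1 R82) · 𝔹-RATIO = (a) [FrdI] Cor 4.10/Thm 5.2 (ii) (this seat) + (b) classical Kummer
rigidity (abc-iut-L5-t16). ([IUTchI] Cor 5.3 (i) p.144) [cite: MochizukiFrdI2008, Cor. 4.11 (iv) p.92] [claim: Mochizuki2012, status: disputed] -/
theorem arith_rigidOverBase : CatIsomorphism.RigidOverBase (GlobalDivisorData.arith F).modelBase :=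
  arith_rigidOverBase_of_unitsTransport F (fun Ψ η => arith_exists_unitsAut_of_overBase F Ψ η)

/-- **[IUTchI] Cor 5.3 (i): the natural map `Aut(ℱ^⊛(†𝒟^⊚)) → Aut(†𝒟^⊛)` is INJECTIVE — UNCONDITIONALLY** (the §0 map
`CatIsomorphism.descend`, its existence/uniqueness binders discharged by abc-iut-w4-d109's ★ `hasUnder_modelBase_arith` /
`underUnique_modelBase_arith`; injectivity from `hker⊛` through abc-iut-L5-t4's ★ `arith_descend_injective_of_kernel_trivial` chain).
([IUTchI] Cor 5.3 (i) p.144) [cite: MochizukiFrdI2008, Cor. 4.11 (ii) p.91] [claim: Mochizuki2012, status: disputed] -/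
theorem arith_descend_injective :
    Function.Injective (CatIsomorphism.descend (GlobalDivisorData.hasUnder_modelBase_arith F F)
      (GlobalDivisorData.underUnique_modelBase_arith F F)) :=
  arith_descend_injective_of_divMonoidRigid_of_ratioRigid F (GlobalDivisorData.arith_divMonoid_eq_self_of_map_divB F)
    (arith_ratioRigid F)

/-- **[IUTchI] Cor 5.3 (i) AS PRINTED («bijective») at `ℱ^⊛(†𝒟^⊚)` modulo the SURJECTIVITY input `hlift⊛` ALONE** (every base
self-equivalence of `†𝒟^⊛` lifts to `ℱ^⊛(†𝒟^⊚)` — print's functoriality of `†𝒟^⊚ ↦ ℱ^⊛(†𝒟^⊚)`; displayed, not proved here).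
([IUTchI] Cor 5.3 (i) p.144) [cite: MochizukiFrdI2008, Cor. 4.11 (ii) p.91] [claim: Mochizuki2012, status: disputed] -/
theorem arith_descendBijective_of_lifts
    (hlift : ∀ Θ : BaseCat (absGalGrp F) ≌ BaseCat (absGalGrp F),
      ∃ Ψ : (GlobalDivisorData.arith F).ModelGlobalFrobenioid ≌ (GlobalDivisorData.arith F).ModelGlobalFrobenioid,
        Nonempty (CatIsomorphism.LiesUnder (GlobalDivisorData.arith F).modelBase (GlobalDivisorData.arith F).modelBase Ψ Θ)) :
    CatIsomorphism.DescendBijective (GlobalDivisorData.arith F).modelBase (GlobalDivisorData.arith F).modelBase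
      (GlobalDivisorData.hasUnder_modelBase_arith F F) (GlobalDivisorData.underUnique_modelBase_arith F F) :=
  arith_descendBijective_of_unitsTransport_of_lifts F (fun Ψ η => arith_exists_unitsAut_of_overBase F Ψ η) hlift

/-- **[IUTchI] Cor 5.3 (i) AS PRINTED («bijective») at `ℱ^⊛(†𝒟^⊚)` modulo the named FACT `NeukirchUchida F` ALONE**
([NSW] Thm (12.2.1), consumed BY NAME): the lift `hlift⊛` is abc-iut-w4-d109's ★ `liftsAll_modelBase_arith_of_neukirchUchida`.
CENSUS of the `⊛`-slot: injectivity PROVED (LAW ∅ · FACT ∅); bijectivity ⟸ FACT {`NeukirchUchida`}.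
([IUTchI] Cor 5.3 (i) p.144) [cite: NeukirchSchmidtWingberg2008, Thm (12.2.1)] [claim: Mochizuki2012, status: disputed] -/
theorem arith_descendBijective_of_neukirchUchida (hNU : NeukirchUchida F) :
    CatIsomorphism.DescendBijective (GlobalDivisorData.arith F).modelBase (GlobalDivisorData.arith F).modelBase
      (GlobalDivisorData.hasUnder_modelBase_arith F F) (GlobalDivisorData.underUnique_modelBase_arith F F) :=
  arith_descendBijective_of_lifts F (GlobalDivisorData.liftsAll_modelBase_arith_of_neukirchUchida F hNU)

end Cor53

end Literature.IUT.HodgeTheaters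

end
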